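import Literature.NumberTheory.Automorphic.CDTTheorem712
import Literature.NumberTheory.EllipticCurves.ModFiveCongruenceHesseFamily
import Literature.NumberTheory.EllipticCurves.ModThreeReducibleIffPsi3Root
import HarnessLib

/-!
# stub-ideation k3 (FAMILY 3 — probe the extremes) for `stub_switch` = `CDT_three_five_switch`

Sketch file: helper-lemma SIGNATURES (sorried, one prover cycle each unless marked) and the
sorry-free assembly `helpers ⇒ stub_switch`.  Not a proposal; lives in the seat folder only.

Autopsy of the signature (extremes): hypotheses `¬ 27 ∣ N`, (ii) `E[3]|ℚ(√-3)` not abs. irreducible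
and (iii) `ρ` abs. irreducible over `ℚ(√5)` are INERT — `W` itself is an elliptic source of `ρ`, so
`X_W(5) ≅ ℙ¹` (Fisher's explicit Hesse family, tree NAMED FACT `thm132_geomTorsionFive_of_hesseFamily`)
and the whole content is: some member `E_{l,1}` of the family has `ρ̄_{E,3}` onto.  Onto at `3` is
certified by Serre's criterion (`Ψ₃` rootless ∧ `Δ ∉ ℚ³`); `Δ ∉ ℚ³` is forced `ℓ`-adically next to a
CUSP of `X_W(5)` (syzygy `Δ(E_{l,m}) = Δ_W · 𝔇(l,m)⁵`, `5 ≢ 0 mod 3`); `Ψ₃` rootless is the one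
residual Diophantine atom (three typed candidates R1/R2/R3 below).
-/

namespace Summit.ABC.ABC.Cruxes.FreyModularity.StubSwitchK3

open Literature.NumberTheory.EllipticCurves Literature.NumberTheory.EllipticCurves.HesseFamilyFive
open Literature.NumberTheory.Automorphic Literature.NumberTheory.GaloisRepresentations
open Literature.NumberTheory.Automorphic.BCDT WeierstrassCurve Polynomial Matrix

noncomputable section

/-- Fisher's Hesse member `E_{l,m} : y² = x³ − 27𝔠₄(l,m)x − 54𝔠₆(l,m)` over `(c₄, c₆)`. -/
abbrev member (c₄ c₆ l m : ℚ) : WeierstrassCurve ℚ :=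
  ⟨0, 0, 0, -27 * C4 c₄ c₆ l m, -54 * C6 c₄ c₆ l m⟩

/-- The `c₄c₆`-model `y² = x³ − 27c₄x − 54c₆` (= the member at `(l:m) = (1:0)`). -/
abbrev base (c₄ c₆ : ℚ) : WeierstrassCurve ℚ := ⟨0, 0, 0, -27 * c₄, -54 * c₆⟩

/-! ## H1 — transport of a framed `5`-torsion model along a `5`-congruence (S) -/

theorem isTorsionGaloisRep_of_congr {W W' : WeierstrassCurve ℚ} (h : Congr W' W)
    {ρ : ModPGaloisRep ℚ (ZMod 5) 2} (hρ : W.IsTorsionGaloisRep 5 ρ) :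
    W'.IsTorsionGaloisRep 5 ρ := by
  obtain ⟨e', he'⟩ := h
  obtain ⟨e, he⟩ := hρ
  refine ⟨e'.trans e, fun σ P => ?_⟩
  rw [AddEquiv.trans_apply, AddEquiv.trans_apply, he', he]

/-! ## H2a — intrinsic onto ⇒ framed onto (IN TREE, PROVED:
`Summit.ABC.ABC.Theorems.surjective_of_hasSurjectiveModNGaloisRep`; copied verbatim so that this sketch
does not import the unbuilt `…StubFreyCaseBSixteen` chain) -/

theorem surjective_of_hasSurjectiveModNGaloisRep {F : Type} [Field F] {W : WeierstrassCurve F}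
    {p : ℕ} [Fact p.Prime] (hs : W.HasSurjectiveModNGaloisRep (p : ℤ)) {ρ : ModPGaloisRep F (ZMod p) 2}
    (hρ : W.IsTorsionGaloisRep p ρ) : Function.Surjective ρ := by
  obtain ⟨e, he⟩ := hρ
  intro M
  let f : (Fin 2 → ZMod p) ≃+ (Fin 2 → ZMod p) :=
    { toFun := fun v ↦ (M : Matrix (Fin 2) (Fin 2) (ZMod p)) *ᵥ v
      invFun := fun v ↦ ((M⁻¹ : GL (Fin 2) (ZMod p)) : Matrix (Fin 2) (Fin 2) (ZMod p)) *ᵥ v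
      left_inv := fun v ↦ by
        simp only [Matrix.mulVec_mulVec, Units.inv_mul, Matrix.one_mulVec]
      right_inv := fun v ↦ by
        simp only [Matrix.mulVec_mulVec, Units.mul_inv, Matrix.one_mulVec]
      map_add' := fun v w ↦ Matrix.mulVec_add _ _ _ }
  have hf : ∀ v, f v = (M : Matrix (Fin 2) (Fin 2) (ZMod p)) *ᵥ v := fun _ ↦ rfl
  obtain ⟨σ, hσ⟩ := hs (Multiplicative.ofAdd (e.trans (f.trans e.symm)))
  have hσP : ∀ P : geomTorsion W p, σ • P = e.symm (f (e P)) := fun P ↦ by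
    have h := W.galoisRepTorsion_apply (p : ℤ) σ P
    rw [hσ, toAdd_ofAdd] at h
    exact h.symm
  refine ⟨σ, ?_⟩
  have hv : ∀ v : Fin 2 → ZMod p,
      ((ρ σ : GL (Fin 2) (ZMod p)) : Matrix (Fin 2) (Fin 2) (ZMod p)) *ᵥ v =
        (M : Matrix (Fin 2) (Fin 2) (ZMod p)) *ᵥ v := fun v ↦ by
    have h := he σ (e.symm v)
    rw [hσP, AddEquiv.apply_symm_apply, AddEquiv.apply_symm_apply, hf] at h
    exact h.symm
  have hmat : ((ρ σ : GL (Fin 2) (ZMod p)) : Matrix (Fin 2) (Fin 2) (ZMod p)) =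
      (M : Matrix (Fin 2) (Fin 2) (ZMod p)) :=
    Matrix.toLin'.injective (LinearMap.ext fun v ↦ by rw [Matrix.toLin'_apply, Matrix.toLin'_apply, hv])
  exact Units.ext hmat

/-! ## H2 — the stub is EQUIVALENT in content to the hypothesis-free elliptic-source statement (S) -/

/-- `X_W(5)(ℚ) ∋` a point with big mod-`3` image: every elliptic `W/ℚ` has a `5`-congruent `W'/ℚ`
with `ρ̄_{W',3}` onto `GL₂(𝔽₃)` (Wiles 1995 Ch. 5; Rubin, CSS 1997, §4). -/
def EllipticSourceSwitch : Prop :=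
  ∀ (W : WeierstrassCurve ℚ) [W.IsElliptic],
    ∃ (W' : WeierstrassCurve ℚ) (_ : W'.IsElliptic), Congr W' W ∧
      W'.HasSurjectiveModNGaloisRep ((3 : ℕ) : ℤ)

/-- glue: `EllipticSourceSwitch ⇒ stub_switch` (all three hypotheses of the stub unused). -/
theorem switch_of_ellipticSourceSwitch (h : EllipticSourceSwitch) : CDT_three_five_switch := by
  intro W _ _ _ ρ hρ _
  obtain ⟨W', hW', hc, hs⟩ := h W
  haveI := hW'
  obtain ⟨ρ₃, hρ₃⟩ := W'.exists_isTorsionGaloisRep 3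
  exact ⟨W', hW', isTorsionGaloisRep_of_congr hc hρ, ρ₃, hρ₃,
    isAbsIrreducibleOverSqrt_neg_three_of_surjective ρ₃
      (surjective_of_hasSurjectiveModNGaloisRep hs hρ₃)⟩

/-! ## H3 — Serre's criterion at `3` (M): `Ψ₃` rootless ∧ `Δ ∉ ℚ³` ⇒ `ρ̄₃` onto
Tools: `hasIrreducibleModPGaloisRep_three_iff_forall_not_isRoot_Ψ₃` (tree, PROVED),
`Serre1972.eq_top_or_borel_of_dvd_card` (tree, PROVED), det onto from `exists_frame_galoisRepTorsion_rat`,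
and H3a. -/

/-- H3a (M): `∛Δ ∈ ℚ(E[3])` (`ThreeTorsionRadicalsProofs.pair_mul_add_pair_mul_eq`:
`δ = b₄ − 3(x₁x₂ + x₃x₄)`), so `Δ ∉ ℚ³ ⇒ 3 ∣ #ρ̄₃(Γ_ℚ)` (orbit of `δ` has `3` elements; or:
a `2`-group image fixes one of the three pairings `δ, ωδ, ω²δ`). Serre 1972 §5.3. -/
theorem three_dvd_natCard_range_galoisRepTorsion_of_forall_ne_cube (V : WeierstrassCurve ℚ)
    [V.IsElliptic] (hΔ : ∀ d : ℚ, V.Δ ≠ d ^ 3) :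
    3 ∣ Nat.card (galoisRepTorsion V ((3 : ℕ) : ℤ)).range := by
  sorry

/-- H3 (S given H3a): Serre 1972 §5.3 / Prop. 15 at `p = 3`: irreducible (no stable line, so not
Borel) ∧ `3 ∣ #G` (H3a) ∧ `det = χ₃` onto (`exists_frame_galoisRepTorsion_rat`) ⇒ `G = GL₂(𝔽₃)` by
`Serre1972.eq_top_or_borel_of_dvd_card` (tree, PROVED), transported back through the frame. -/
theorem hasSurjectiveModNGaloisRep_three_of_irreducible_of_forall_ne_cube
    (V : WeierstrassCurve ℚ) [V.IsElliptic] (hirr : V.HasIrreducibleModPGaloisRep 3)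
    (hΔ : ∀ d : ℚ, V.Δ ≠ d ^ 3) : V.HasSurjectiveModNGaloisRep ((3 : ℕ) : ℤ) := by
  sorry

/-! ## H4 — Fisher's syzygy `𝔠₄³ − 𝔠₆² = (c₄³ − c₆²)𝔇⁵` read on discriminants (S/M: `ring`, heavy) -/

theorem Δ_member (c₄ c₆ l m : ℚ) :
    (member c₄ c₆ l m).Δ = (base c₄ c₆).Δ * (D c₄ c₆ l m) ^ 5 := by
  sorry

/-! ## H5 — CUSP-ADJACENT FORCING (M): an `ℓ`-adic residue class on which `3 ∤ v_ℓ(Δ(E_{l,1}))`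
`𝔇(c₄,c₆,·,1)` is monic of degree `12` and never `const·cube` (coefficients `λ¹¹…λ⁶` force
`c₄c₆ = 0`, then `c₄ = c₆ = 0`); take an irreducible factor `g` of multiplicity `m`, `3 ∤ m`;
Schur: a prime `ℓ ∉ S` with a simple root `a₀` of `g mod ℓ`; Hensel step: a class `a mod ℓ²` with
`v_ℓ(g(l)) = 1`, `v_ℓ(cofactor) = 0`, so `v_ℓ(Δ(E_{l,1})) = 5m ≢ 0 (mod 3)` on the whole class. -/

/-- H5a (S): Schur 1912 — a nonconstant integer polynomial has a root modulo infinitely many primes.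
NOT in Mathlib (only the cyclotomic case `Nat.exists_prime_gt_modEq_one`). -/
theorem infinite_setOf_prime_dvd_eval (f : ℤ[X]) (hf : 0 < f.natDegree) :
    {ℓ : ℕ | ℓ.Prime ∧ ∃ n : ℤ, (ℓ : ℤ) ∣ f.eval n}.Infinite := by
  sorry

/-- H5 (M): the cusp-adjacent residue class, at a prime outside any prescribed finite set. -/
theorem exists_prime_residue_not_three_dvd_padicValRat_Δ (c₄ c₆ : ℚ) (hΔ : c₄ ^ 3 ≠ c₆ ^ 2)
    (S : Finset ℕ) :
    ∃ (ℓ : ℕ) (a : ℤ), ℓ.Prime ∧ ℓ ∉ S ∧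
      ∀ l : ℤ, (l : ZMod (ℓ ^ 2)) = a →
        (member c₄ c₆ l 1).Δ ≠ 0 ∧ ¬ (3 : ℤ) ∣ padicValRat ℓ (member c₄ c₆ l 1).Δ := by
  sorry

/-- H5c (XS): a residue class mod `ℓ²` is infinite, so it is not exhausted by a finite set. -/
theorem exists_mem_residueClass_not_mem {ℓ : ℕ} (hℓ : ℓ.Prime) (a : ℤ) {T : Set ℤ}
    (hT : T.Finite) : ∃ l : ℤ, (l : ZMod (ℓ ^ 2)) = a ∧ l ∉ T := by
  sorry

/-- H5b (XS): `3 ∤ v_ℓ(Δ)` ⇒ `Δ` is not a cube. -/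
theorem forall_ne_cube_of_not_three_dvd_padicValRat {ℓ : ℕ} (hℓ : ℓ.Prime) {q : ℚ} (hq : q ≠ 0)
    (h : ¬ (3 : ℤ) ∣ padicValRat ℓ q) : ∀ d : ℚ, q ≠ d ^ 3 := by
  sorry

/-! ## H6 — THE RESIDUAL ATOM: a member with `Ψ₃` rootless (irreducible `E[3]`), three typed forms
R1 (named-fact road, Faltings): Rubin 1997 Lemma 12 (`Y'_E(ℚ)` finite, genus `9`) read on Fisher's
  coordinate — cofinitely many `l` have `E_{l,1}[3]` irreducible.
R2 (HIT road): every residue class contains such an `l` (Hilbert irreducibility, Serre TGT §3.4, plus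
  genericity of the level-`3` structure over `ℚ(λ)` — coprime levels `3`, `5`).
R3 (local road, weakest, tree-provable in principle): ONE good prime `q` and ONE class `b mod q` on which
  `Ψ₃(E_{l,1})` has no root MOD `q` (supersingular `j = 1728` fibre at `q ≡ 7 (12)` with `a_q(W) ≡ 0 (5)`:
  Chebotarev (tree `exists_isArithFrobAt_mul_inv_mem_not_mem`, PROVED) + Fisher 13.2 (ii) over `𝔽_q`). -/

/-- R1. [Rubin CSS 1997, Lemma 12 + Prop. 6; Fisher 2012 Thm. 13.2] -/
def RubinFiniteness : Prop :=
  ∀ (c₄ c₆ : ℚ), c₄ ^ 3 ≠ c₆ ^ 2 →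
    {l : ℤ | ¬ ((member c₄ c₆ l 1).Δ ≠ 0 ∧ (member c₄ c₆ l 1).HasIrreducibleModPGaloisRep 3)}.Finite

/-- R2. [Serre, Topics in Galois Theory, §3.4; Rubin–Silverberg 1995] -/
def HilbertResidueClass : Prop :=
  ∀ (c₄ c₆ : ℚ), c₄ ^ 3 ≠ c₆ ^ 2 → ∀ (N : ℕ), 0 < N → ∀ a : ℤ,
    ∃ l : ℤ, (l : ZMod N) = a ∧ (member c₄ c₆ l 1).Δ ≠ 0 ∧
      ∀ x : ℚ, ¬ (member c₄ c₆ l 1).Ψ₃.IsRoot x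

/-- R3. one good prime and residue class (every member of the class is `3`-irreducible). -/
def OneGoodPrime : Prop :=
  ∀ (c₄ c₆ : ℚ), c₄ ^ 3 ≠ c₆ ^ 2 →
    ∃ (q : ℕ) (b : ℤ), q.Prime ∧ ∀ l : ℤ, (l : ZMod q) = b → (member c₄ c₆ l 1).Δ ≠ 0 →
      ∀ x : ℚ, ¬ (member c₄ c₆ l 1).Ψ₃.IsRoot x

/-- H6c (XS, CRT): a class mod `ℓ²` and a class mod a different prime `q` have a common member. -/
theorem exists_common_member {ℓ q : ℕ} (hℓ : ℓ.Prime) (hq : q.Prime) (hne : ℓ ≠ q) (a b : ℤ) :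
    ∃ l : ℤ, (l : ZMod (ℓ ^ 2)) = a ∧ (l : ZMod q) = b := by
  sorry

/-! ## Assembly (sorry-free modulo the helpers): Fisher fact + H3 + H5 + ONE residual atom ⇒ stub -/

/-- common tail: a member `E_{l,1}` in the cusp-adjacent class with irreducible `E[3]` does it. -/
theorem ellipticSourceSwitch_of_member (hF : thm132_geomTorsionFive_of_hesseFamily)
    (W : WeierstrassCurve ℚ) [W.IsElliptic] {ℓ : ℕ} (hℓ : ℓ.Prime) {a : ℤ}
    (hcls : ∀ l : ℤ, (l : ZMod (ℓ ^ 2)) = a →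
      (member W.c₄ W.c₆ l 1).Δ ≠ 0 ∧ ¬ (3 : ℤ) ∣ padicValRat ℓ (member W.c₄ W.c₆ l 1).Δ)
    {l : ℤ} (hl : (l : ZMod (ℓ ^ 2)) = a)
    (hirr : ∀ _ : (member W.c₄ W.c₆ l 1).IsElliptic, (member W.c₄ W.c₆ l 1).HasIrreducibleModPGaloisRep 3) :
    ∃ (W' : WeierstrassCurve ℚ) (_ : W'.IsElliptic), Congr W' W ∧
      W'.HasSurjectiveModNGaloisRep ((3 : ℕ) : ℤ) := by
  set E' : WeierstrassCurve ℚ := member W.c₄ W.c₆ l 1 with hE'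
  have hΔl : E'.Δ ≠ 0 := (hcls l hl).1
  haveI hE'ell : E'.IsElliptic := ⟨isUnit_iff_ne_zero.mpr hΔl⟩
  haveI : (base W.c₄ W.c₆).IsElliptic := isElliptic_fisherModel W
  -- onto at `3` by Serre's criterion
  have hcube : ∀ d : ℚ, E'.Δ ≠ d ^ 3 :=
    forall_ne_cube_of_not_three_dvd_padicValRat hℓ hΔl (hcls l hl).2
  have h3 : E'.HasSurjectiveModNGaloisRep ((3 : ℕ) : ℤ) :=
    hasSurjectiveModNGaloisRep_three_of_irreducible_of_forall_ne_cube E' (hirr hE'ell) hcube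
  -- `5`-congruent to `W` by Fisher's theorem
  obtain ⟨e, he⟩ := hF (base W.c₄ W.c₆) E' W.c₄ W.c₆ l 1 rfl hE'
  have hc : Congr E' W := congr_trans ⟨e, he⟩ (congr_symm (congr_fisherModel W))
  exact ⟨E', hE'ell, hc, h3⟩

theorem c_rel_ne (W : WeierstrassCurve ℚ) [W.IsElliptic] : W.c₄ ^ 3 ≠ W.c₆ ^ 2 := by
  intro h
  have h1728 : (1728 : ℚ) * W.Δ = W.c₄ ^ 3 - W.c₆ ^ 2 := W.c_relation
  rw [h, sub_self] at h1728
  exact W.isUnit_Δ.ne_zero (by simpa using h1728)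

/-- ROAD A (named-fact road): Fisher 13.2 (i) + Rubin's finiteness (Faltings) + H3 + H5 ⇒ the switch. -/
theorem ellipticSourceSwitch_of_rubin (hF : thm132_geomTorsionFive_of_hesseFamily)
    (hR : RubinFiniteness) : EllipticSourceSwitch := by
  intro W _
  obtain ⟨ℓ, a, hℓ, -, hcls⟩ :=
    exists_prime_residue_not_three_dvd_padicValRat_Δ W.c₄ W.c₆ (c_rel_ne W) ∅
  obtain ⟨l, hl, hlT⟩ := exists_mem_residueClass_not_mem hℓ a (hR W.c₄ W.c₆ (c_rel_ne W))
  simp only [Set.mem_setOf_eq, not_not] at hlT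
  exact ellipticSourceSwitch_of_member hF W hℓ hcls hl (fun _ => hlT.2)

/-- ROAD B (Hilbert road): Fisher 13.2 (i) + residue-class HIT + H3 + H5 ⇒ the switch. -/
theorem ellipticSourceSwitch_of_hilbert (hF : thm132_geomTorsionFive_of_hesseFamily)
    (hR : HilbertResidueClass) : EllipticSourceSwitch := by
  intro W _
  obtain ⟨ℓ, a, hℓ, -, hcls⟩ :=
    exists_prime_residue_not_three_dvd_padicValRat_Δ W.c₄ W.c₆ (c_rel_ne W) ∅
  obtain ⟨l, hl, -, hΨ⟩ := hR W.c₄ W.c₆ (c_rel_ne W) (ℓ ^ 2) (pow_pos hℓ.pos 2) a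
  exact ellipticSourceSwitch_of_member hF W hℓ hcls hl
    (fun _ => ((member W.c₄ W.c₆ l 1).hasIrreducibleModPGaloisRep_three_iff_forall_not_isRoot_Ψ₃).2 hΨ)

/-- ROAD C (local road): Fisher 13.2 (i) + one good prime + CRT + H3 + H5 ⇒ the switch. -/
theorem ellipticSourceSwitch_of_oneGoodPrime (hF : thm132_geomTorsionFive_of_hesseFamily)
    (hR : OneGoodPrime) : EllipticSourceSwitch := by
  intro W _
  obtain ⟨q, b, hq, hgood⟩ := hR W.c₄ W.c₆ (c_rel_ne W)
  obtain ⟨ℓ, a, hℓ, hℓS, hcls⟩ :=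
    exists_prime_residue_not_three_dvd_padicValRat_Δ W.c₄ W.c₆ (c_rel_ne W) {q}
  obtain ⟨l, hl, hlb⟩ := exists_common_member hℓ hq (by simpa using hℓS) a b
  exact ellipticSourceSwitch_of_member hF W hℓ hcls hl
    (fun _ => ((member W.c₄ W.c₆ l 1).hasIrreducibleModPGaloisRep_three_iff_forall_not_isRoot_Ψ₃).2
      (hgood l hlb (hcls l hl).1))

/-- The line: Fisher 13.2 (i) (tree named fact, PUB) + ONE residual atom ⇒ `stub_switch`. -/
theorem stub_switch_of_helpers (hF : thm132_geomTorsionFive_of_hesseFamily)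
    (hR : RubinFiniteness ∨ HilbertResidueClass ∨ OneGoodPrime) : CDT_three_five_switch :=
  switch_of_ellipticSourceSwitch <| hR.elim (ellipticSourceSwitch_of_rubin hF)
    fun h => h.elim (ellipticSourceSwitch_of_hilbert hF) (ellipticSourceSwitch_of_oneGoodPrime hF)

end

end Summit.ABC.ABC.Cruxes.FreyModularity.StubSwitchK3
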